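import Summits.CriticalPhenomena.PercolationContinuityZ3.Theorems.Transplant.FKConnectivityAllQAntipodalTwoSpineDefs
import Summits.CriticalPhenomena.PercolationContinuityZ3.Theorems.Transplant.FKConnectivityAllQAntipodalX2Pos
import HarnessLib

/-!
# Two-spine word model of `U¹¹` — ONE-SIDE SEMANTICS: the open-mode row data of a configuration are read off its spine word

Theorem file (`--supports stmt-CriticalPhenomena-4575`), FK sub-lane `prim-bschramm-fk-2` (gen 15); builds on p205010 (kernel
theorem, internal audit signed; external expert review pending).  No definitions, no named facts, no sorries.

For the spine `ps` of the marked edge `y = y₁y₂` in a two-terminal series–parallel network `A` between `s, m` (`IsSpine ps {y} y₁ y₂ A s m`,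
gen 14) and a configuration `X ⊆ T = A ∖ y` with σ-word `w = spineWord ps T X`, the OPEN-MODE row quantities of `…TwoSpineDefs` are the
graph quantities of the four half-pairs `X`, `T ∖ X`, `X ∪ y`, `(T ∖ X) ∪ y`:
* `Mode.o.conn (sRowA w) = 1{s ↔ m in X}`, `Mode.o.conn (sRowB w) = 1{s ↔ m in T ∖ X}` (`IsSpine.apConn_terminals_eq`);
* `Mode.o.connDot (sRowA w) = 1{s ↔ m in X ∪ y}`, likewise for row `B` (`IsSpine.reach_iff` with the inner composite `{y}` open);
* `q · q^{k(X ∪ y)} = q^{k(X)} · q^{1 - rowDel (sRowA w)}` (`pow_clusterCount_insert`, `IsSpine.apConn_marked_eq`), likewise for `T ∖ X`.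
Together with gen 14's `IsSpine.pow_apExp_eq` (`q^{k(X)+k(T∖X)} = wordCoef(w) · q^{expSum X}`) this is the one-side input of the semantic bridge
`U¹¹(A ∘ B) = Σ_{(u,v)} Θ^{(o,o,o,o)}(u,v) · fiber2(u,v)` (memo g15 §8, W3).
[cite: Grimmett2006, §1.4 eq. (1.20) (p. 15); §3.8 (pp. 61–62)]
-/

noncomputable section

namespace Summit.CriticalPhenomena.PercolationContinuityZ3.Theorems

namespace FK

namespace TwoSpine

open SimpleGraph Literature.Probability.LatticeModels Literature.Probability.Percolation X2Word
open scoped Classical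

variable {V : Type*} [Fintype V]
variable {ps : List (SpinePart V)} {A T : Finset (Sym2 V)} {y₁ y₂ s m : V}

omit [Fintype V] in
/-- Inserting an edge outside every part does not change the row word of a configuration. [folklore] -/
theorem rowOf_insert_of_not_mem {z : Sym2 V} (hz : ∀ p ∈ ps, z ∉ p.R) (X : Finset (Sym2 V)) :
    rowOf ps (insert z X) = rowOf ps X := by
  unfold rowOf
  congr 1
  refine List.filter_congr fun p hp => ?_
  have : insert z X ∩ p.R = X ∩ p.R := by
    rw [Finset.insert_inter_of_notMem (hz p hp)]
  unfold SpinePart.bit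
  rw [this]

omit [Fintype V] in
/-- The open mode reads the row's own dotted connection. [folklore] -/
@[simp] theorem Mode.connDot_o (r : List Kind) : Mode.o.connDot r = if rowCdot r then 1 else 0 := rfl

omit [Fintype V] in
/-- **Open-mode connection of row `A`** = terminal connection of `X`. [folklore] -/
theorem conn_o_rowA (h : IsSpine ps {s(y₁, y₂)} y₁ y₂ A s m) (hy : y₁ ≠ y₂) (hT : T ⊆ A.erase s(y₁, y₂)) {X : Finset (Sym2 V)} (hX : X ⊆ T) :
    Mode.o.conn (sRowA (spineWord ps T X)) = apConn X s m := by
  have hTA : T ⊆ A := hT.trans (Finset.erase_subset _ _)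
  have hzX : s(y₁, y₂) ∉ X := fun hz => Finset.notMem_erase _ _ (hT (hX hz))
  rw [Mode.conn_o, rowC, sRowA_spineWord, h.apConn_terminals_eq hy (hX.trans hTA) hzX]

omit [Fintype V] in
/-- **Open-mode connection of row `B`** = terminal connection of `T ∖ X`. [folklore] -/
theorem conn_o_rowB (h : IsSpine ps {s(y₁, y₂)} y₁ y₂ A s m) (hy : y₁ ≠ y₂) (hT : T ⊆ A.erase s(y₁, y₂)) (X : Finset (Sym2 V)) :
    Mode.o.conn (sRowB (spineWord ps T X)) = apConn (T \ X) s m := by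
  have hTA : T ⊆ A := hT.trans (Finset.erase_subset _ _)
  have hz : s(y₁, y₂) ∉ T \ X := fun hz => Finset.notMem_erase _ _ (hT (Finset.sdiff_subset hz))
  rw [Mode.conn_o, rowC, sRowB_spineWord, h.apConn_terminals_eq hy (Finset.sdiff_subset.trans hTA) hz]

omit [Fintype V] in
/-- Terminal connection with the marked edge inserted, through the row word: `1{s ↔ m in ω ∪ y} = rowCdot (rowOf ps ω)`. [folklore] -/
theorem apConn_insert_eq (h : IsSpine ps {s(y₁, y₂)} y₁ y₂ A s m) (hy : y₁ ≠ y₂) {ω : Finset (Sym2 V)} (hω : ω ⊆ A) :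
    apConn (insert s(y₁, y₂) ω) s m = if rowCdot (rowOf ps ω) then 1 else 0 := by
  have hyA : s(y₁, y₂) ∈ A := h.subset (Finset.mem_singleton_self _)
  have hω' : insert s(y₁, y₂) ω ⊆ A := Finset.insert_subset hyA hω
  have hc : true = true ↔ (openGraph (↑(insert s(y₁, y₂) ω ∩ {s(y₁, y₂)}) : BondConfig V)).Reachable y₁ y₂ := by
    refine ⟨fun _ => ?_, fun _ => rfl⟩
    have hmem : s(y₁, y₂) ∈ (↑(insert s(y₁, y₂) ω ∩ {s(y₁, y₂)}) : BondConfig V) := by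
      rw [Finset.mem_coe, Finset.mem_inter]; exact ⟨Finset.mem_insert_self _ _, Finset.mem_singleton_self _⟩
    exact Adj.reachable ((openGraph_adj _ _ _).2 ⟨hmem, hy⟩)
  have key := h.reach_iff hy (insert s(y₁, y₂) ω) hω' hc
  rw [rowOf_insert_of_not_mem (fun p hp hz => Finset.disjoint_left.1 (h.disjoint_parts p hp) (Finset.mem_singleton_self _) hz)] at key
  have hflag : lastFlag true (rowOf ps ω) = rowCdot (rowOf ps ω) := by
    unfold lastFlag rowCdot
    cases rowOf ps ω <;> simp
  rw [hflag] at key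
  unfold apConn
  by_cases hr : (openGraph (↑(insert s(y₁, y₂) ω) : BondConfig V)).Reachable s m
  · rw [if_pos hr, if_pos (key.2 hr)]
  · rw [if_neg hr, if_neg (fun hh => hr (key.1 hh))]

omit [Fintype V] in
/-- **Open-mode dotted connection of row `A`** = terminal connection of `X ∪ y`. [folklore] -/
theorem connDot_o_rowA (h : IsSpine ps {s(y₁, y₂)} y₁ y₂ A s m) (hy : y₁ ≠ y₂) (hT : T ⊆ A.erase s(y₁, y₂)) {X : Finset (Sym2 V)} (hX : X ⊆ T) :
    Mode.o.connDot (sRowA (spineWord ps T X)) = apConn (insert s(y₁, y₂) X) s m := by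
  have hTA : T ⊆ A := hT.trans (Finset.erase_subset _ _)
  rw [Mode.connDot_o, sRowA_spineWord, apConn_insert_eq h hy (hX.trans hTA)]

omit [Fintype V] in
/-- **Open-mode dotted connection of row `B`** = terminal connection of `(T ∖ X) ∪ y`. [folklore] -/
theorem connDot_o_rowB (h : IsSpine ps {s(y₁, y₂)} y₁ y₂ A s m) (hy : y₁ ≠ y₂) (hT : T ⊆ A.erase s(y₁, y₂)) (X : Finset (Sym2 V)) :
    Mode.o.connDot (sRowB (spineWord ps T X)) = apConn (insert s(y₁, y₂) (T \ X)) s m := by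
  have hTA : T ⊆ A := hT.trans (Finset.erase_subset _ _)
  rw [Mode.connDot_o, sRowB_spineWord, apConn_insert_eq h hy (Finset.sdiff_subset.trans hTA)]

/-- **Open-mode `δ` of row `A`**: `q · q^{k(X ∪ y)} = q^{k(X)} · q^{1 - rowDel (sRowA w)}` (inserting the marked edge saves a cluster iff
its ends are not yet joined, i.e. iff the row does not start with a particle). [cite: Grimmett2006, §1.2] -/
theorem pow_clusterCount_insert_rowA (q : ℝ) (h : IsSpine ps {s(y₁, y₂)} y₁ y₂ A s m) (hy : y₁ ≠ y₂) (hT : T ⊆ A.erase s(y₁, y₂))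
    {X : Finset (Sym2 V)} (hX : X ⊆ T) :
    q * q ^ clusterCount (↑(insert s(y₁, y₂) X) : BondConfig V) ∅ =
      q ^ clusterCount (↑X : BondConfig V) ∅ * q ^ (1 - Mode.o.del (sRowA (spineWord ps T X))) := by
  have hTA : T ⊆ A := hT.trans (Finset.erase_subset _ _)
  have hzX : s(y₁, y₂) ∉ X := fun hz => Finset.notMem_erase _ _ (hT (hX hz))
  rw [pow_clusterCount_insert, h.apConn_marked_eq hy (hX.trans hTA) hzX, ← sRowA_spineWord (ps := ps) (T := T) (B := X)]
  unfold Mode.del rowDel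
  by_cases hh : headP (sRowA (spineWord ps T X)) = true <;> simp [hh]

/-- **Open-mode `δ` of row `B`**: the same for the complement `T ∖ X`. [cite: Grimmett2006, §1.2] -/
theorem pow_clusterCount_insert_rowB (q : ℝ) (h : IsSpine ps {s(y₁, y₂)} y₁ y₂ A s m) (hy : y₁ ≠ y₂) (hT : T ⊆ A.erase s(y₁, y₂))
    (X : Finset (Sym2 V)) :
    q * q ^ clusterCount (↑(insert s(y₁, y₂) (T \ X)) : BondConfig V) ∅ =
      q ^ clusterCount (↑(T \ X) : BondConfig V) ∅ * q ^ (1 - Mode.o.del (sRowB (spineWord ps T X))) := by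
  have hTA : T ⊆ A := hT.trans (Finset.erase_subset _ _)
  have hz : s(y₁, y₂) ∉ T \ X := fun hz => Finset.notMem_erase _ _ (hT (Finset.sdiff_subset hz))
  rw [pow_clusterCount_insert, h.apConn_marked_eq hy (Finset.sdiff_subset.trans hTA) hz, ← sRowB_spineWord]
  unfold Mode.del rowDel
  by_cases hh : headP (sRowB (spineWord ps T X)) = true <;> simp [hh]

/-- **The open-mode exponent offset of one side through the word**: `q^{k(X)+k(T∖X)} · q^{2LK} = q^{2K} · q^{rowCorr α + rowCorr ᾱ} · q^{expSum X}`
(`K = |V|`, `L` parts; gen 14's `IsSpine.apExp_identity` with `nP - sRuns = corr(α) + corr(ᾱ)`). [cite: Grimmett2006, §1.4 eq. (1.20) (p. 15)] -/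
theorem pow_apExp_rowCorr (q : ℝ) (h : IsSpine ps {s(y₁, y₂)} y₁ y₂ A s m) (hy : y₁ ≠ y₂) (hT : T ⊆ A.erase s(y₁, y₂))
    {X : Finset (Sym2 V)} (hX : X ⊆ T) :
    q ^ apExp T X * q ^ (2 * (ps.length * Fintype.card V)) =
      q ^ (2 * Fintype.card V) * q ^ (rowCorr (sRowA (spineWord ps T X)) + rowCorr (sRowB (spineWord ps T X))) * q ^ expSum ps T X := by
  have hN := h.apExp_identity hy hT hX
  have r1 := adjP_add_runsP (sRowA (spineWord ps T X))
  have r2 := adjP_add_runsP (sRowB (spineWord ps T X))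
  have hN' : apExp T X + 2 * (ps.length * Fintype.card V) =
      2 * Fintype.card V + (rowCorr (sRowA (spineWord ps T X)) + rowCorr (sRowB (spineWord ps T X))) + expSum ps T X := by
    unfold rowCorr; unfold sRuns nP at hN; omega
  rw [← pow_add, ← pow_add, ← pow_add, hN']

end TwoSpine

end FK

end Summit.CriticalPhenomena.PercolationContinuityZ3.Theorems

end
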